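import Summits.RiemannHypothesis.RiemannHypothesis.Theorems.TiltedLandingLaw421R3GenusOneLogDeriv3
import Summits.RiemannHypothesis.RiemannHypothesis.Theorems.TiltedLandingLaw421R3NewtonDoor4
import Literature.Barriers.RiemannHypothesis.EpsteinZetaStark

/-!
# The general-`f` Newton door from primitive data (JOIN of `twoPoint_bound_dslope` and `succ_of_newton_door_twoPointU`)

W-08, crux 33346 `TiltedLandingLaw421R` (route EarlyAppointments), socket S1 of the NewtonDoor endgame map DISCHARGED BY NAME:
C3's `Literature.Analysis.Complex.GenusOneLogDerivC3g41.twoPoint_bound_dslope` (`…R3GenusOneLogDeriv3`) supplies the data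
`a, m, hzeros, hineq, hSv` of C1 g28's fourth door `RhW08.NewtonDoor.succ_of_newton_door_twoPointU` (`…R3NewtonDoor4`), and its
fiber clause turns the list END-sum into the INTRINSIC multiplicity-weighted zero-sum. Two theorems:
* `succ_of_newton_door_genusOne` — `F := f^{(j)}` entire with `‖F z‖ ≤ C e^{‖z‖^ρ}`, `ρ < 2`, `v` a simple zero of `F`,
  `K := h'(v)/h(v)` (`h := dslope F v`), the zeros of `h` `δ`-outside the inflated Newton disc of radius `r_N = (1+ρ₀)/‖K‖`,
  the end number `(1+ρ₀)·(r_N · Σ_{c} ord_h(c)/((‖v−c‖−r_N)‖v−c‖)) < ρ₀‖K‖`, and the slack ⇒ `∃ u, StTrkDQ … (j+1) u`;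
* `succ_of_newton_door_genusOne_frame` — the same with the analytic inputs (`Differentiable`, growth with SOME exponent `< 2`,
  `F v = 0`) discharged from `EngineHyps5` / `StTrkDQ` via the tree's `realEntireLt2_of_hyps`, `exists_growth_iteratedDeriv`,
  `differentiable_iteratedDeriv_of_entire`: only door data remain (simplicity of `v`, `K`, `ρ₀`, offset, `δ`, END number, slack).
Everything here is PROVED (standard axioms); certificate before the two imports land: C3 g41's scratch
`g41/w08/scratch-genusone+newtondoor-v17-join.lean` (v2), which proves these two theorems verbatim over the v6 / v17 bodies.
AI-produced (planner-rh-idea-3-g41-0, 2026-08-30); AI review is weaker than expert review. Nothing here bears on the truth of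
RH; RH is not proved; this is a helper, not the crux: the SUCC residual-designate of record is `DoorAvailLawQ`.
-/

namespace RhW08.NewtonDoorGenusOne

/-- (K) alias for the Literature decl. -/
private abbrev deriv_ne_zero_of_analyticOrderAt_eq_one := @Literature.Barriers.RiemannHypothesis.deriv_ne_zero_of_analyticOrderAt_eq_one

open Complex Set
open Literature.Analysis.Complex.GenusOneLogDerivC3g41
open RhW08.NewtonDoor
open RhW08.Round1 RhW08.StSwap RhW08.Round2 RhW08.QuadW RhW08.SealSwapQ RhW08.SuccB RhW08.SuccSplit RhW08.SuccTheft
open RhW08.Column RhW08.Hurwitz RhW08.ClusterQ RhW08.ClusterQM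
open RhIdea6.G17.W07C7 RhIdea6.G17.W07C7.Rev6 RhIdea6.G18.W07C8.Law421BirthS RhIdea6.G19.W07C11.Seam
open RhIdea6.G20.W07C12.Frac RhIdea6.G20.W07C12.StColP RhW07.C12.FieldSplit RhIdea6.G21.W07C13.TentMax
open RhW07.C14.TwoSided RhW07.C14.Classes RhW07.C14.Lineage RhW07.C14.Booking
open RhW07.C13.Heredity RhIdea6.G22.W07C15pre.Injection RhW07.E3.Cell RhW07.E3.Lit

/-- **The general-f Newton door from primitive data.** `F := f^{(j)}` entire of growth `‖F z‖ ≤ C e^{‖z‖^ρ}`, `ρ < 2`,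
`v` a simple zero of `F` (the tracked state), `K := h'(v)/h(v)` for the cofactor `h := dslope F v`; the zeros of `h`
(= the OTHER zeros of `F`, with multiplicity) stay `δ`-outside the inflated Newton disc of radius `r_N = (1+ρ₀)/‖K‖`,
and the INTRINSIC end condition `(1+ρ₀)·(r_N · Σ_{c : h c = 0} ord_h(c)/((‖v−c‖−r_N)‖v−c‖)) < ρ₀‖K‖` holds. Then
the successor state exists. (C3's `twoPoint_bound_dslope` supplies C1's `a, m, hzeros, hineq, hSv`; the fiber clause
converts C1's list END-sum into the zero-sum written here.) -/
theorem succ_of_newton_door_genusOne {η : ℝ} {f : ℂ → ℂ} {x₀ s hmax R Hs : ℝ} {B j : ℕ} {v : ℂ}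
    (hE : EngineHyps5 2 η f x₀ s hmax R Hs B) (hv : StTrkDQ η f x₀ s hmax R Hs B j v)
    {C ρ : ℝ} (hFd : Differentiable ℂ (iteratedDeriv j f))
    (hgrowth : ∀ z, ‖iteratedDeriv j f z‖ ≤ C * Real.exp (‖z‖ ^ ρ)) (hρ : ρ < 2)
    (hFv : iteratedDeriv j f v = 0) (hsimple : analyticOrderAt (iteratedDeriv j f) v = 1)
    {K : ℂ} (hKdef : K = deriv (dslope (iteratedDeriv j f) v) v / dslope (iteratedDeriv j f) v v)
    (hK : K ≠ 0) (hKy : 1 < ‖K‖ * v.im)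
    {ρ₀ : ℝ} (hρ₀ : 0 < ρ₀) (hoff : ρ₀ / ‖K‖ ≤ |(v - K⁻¹).im|)
    {δ : ℝ} (hδ : 0 < δ)
    (hsepZ : ∀ c, dslope (iteratedDeriv j f) v c = 0 → (1 + ρ₀) / ‖K‖ + δ ≤ ‖v - c‖)
    (hendZ : (1 + ρ₀) * ((1 + ρ₀) / ‖K‖ * ∑' c : ℂ, (analyticOrderNatAt (dslope (iteratedDeriv j f) v) c : ℝ) /
        ((‖v - c‖ - (1 + ρ₀) / ‖K‖) * ‖v - c‖)) < ρ₀ * ‖K‖)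
    (hslack : (rhoN x₀ R v + (1 + ρ₀) / ‖K‖) ^ 2 + ((j : ℝ) + 1) * (v.im + (1 + ρ₀) / ‖K‖) ^ 2 ≤
        ((j : ℝ) + 1) * Hs ^ 2) :
    ∃ u : ℂ, StTrkDQ η f x₀ s hmax R Hs B (j + 1) u := by
  obtain ⟨ι, a, m, hm, haF, hm1, hcard, hfiber, hzeros, hEnd, htwo⟩ :=
    twoPoint_bound_dslope hFd hgrowth hρ hFv hsimple
  have hv0 : dslope (iteratedDeriv j f) v v ≠ 0 := by
    rw [dslope_same]
    exact deriv_ne_zero_of_analyticOrderAt_eq_one (hFd.analyticAt v) hsimple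
  -- the listed points are zeros of the cofactor
  have ha0 : ∀ i, dslope (iteratedDeriv j f) v (a i) = 0 := by
    intro i
    obtain ⟨hz, hne⟩ := haF i
    rw [dslope_of_ne _ hne, slope_def_field, hz, hFv, sub_zero, zero_div]
  have hsep : ∀ i, (1 + ρ₀) / ‖K‖ + δ ≤ ‖v - a i‖ := fun i ↦ hsepZ (a i) (ha0 i)
  have hKn : 0 < ‖K‖ := norm_pos_iff.2 hK
  -- the cofactor does not vanish on the Newton circle
  have hcirc : ∀ z : ℂ, ‖z - (v - K⁻¹)‖ = ρ₀ / ‖K‖ → dslope (iteratedDeriv j f) v z ≠ 0 := by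
    intro z hz hz0
    have h1 : (1 + ρ₀) / ‖K‖ + δ ≤ ‖v - z‖ := hsepZ z hz0
    have h2 : ‖v - z‖ ≤ ρ₀ / ‖K‖ + 1 / ‖K‖ := by
      calc ‖v - z‖ = ‖(v - K⁻¹ - z) + K⁻¹‖ := by congr 1; ring
        _ ≤ ‖v - K⁻¹ - z‖ + ‖K⁻¹‖ := norm_add_le _ _
        _ = ρ₀ / ‖K‖ + 1 / ‖K‖ := by rw [norm_sub_rev, hz, norm_inv, one_div]
    have h3 : ρ₀ / ‖K‖ + 1 / ‖K‖ = (1 + ρ₀) / ‖K‖ := by rw [add_div, add_comm]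
    linarith
  have hzeros' : ∀ z, dslope (iteratedDeriv j f) v z = 0 → ∃ i, z = a i :=
    fun z hz ↦ (hzeros z hz).imp fun i hi ↦ hi.1
  have hineq : ∀ z : ℂ, ‖z - (v - K⁻¹)‖ = ρ₀ / ‖K‖ →
      ‖deriv (dslope (iteratedDeriv j f) v) z / dslope (iteratedDeriv j f) v z - K‖ ≤
        ‖z - v‖ * ∑' i, m i / (‖z - a i‖ * ‖v - a i‖) := by
    intro z hz
    rw [hKdef]
    exact (htwo z v (hcirc z hz) hv0).2
  have hSv : Summable fun i ↦ m i / (‖v - a i‖ * ‖v - a i‖) := (htwo v v hv0 hv0).1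
  -- the list END-sum is the intrinsic zero-sum
  have hs1 : Summable fun i ↦ m i / ((‖v - a i‖ - (1 + ρ₀) / ‖K‖) * ‖v - a i‖) :=
    hEnd ((1 + ρ₀) / ‖K‖) (by positivity) (fun i ↦ by linarith [hsep i])
  have hs2 : Summable fun i ↦ m i * (1 / ((‖v - a i‖ - (1 + ρ₀) / ‖K‖) * ‖v - a i‖)) :=
    hs1.congr fun i ↦ by ring
  have h3 := (hfiber (fun c ↦ 1 / ((‖v - c‖ - (1 + ρ₀) / ‖K‖) * ‖v - c‖)) hs2).tsum_eq
  have hEq : ∑' i, m i / ((‖v - a i‖ - (1 + ρ₀) / ‖K‖) * ‖v - a i‖) =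
      ∑' c : ℂ, (analyticOrderNatAt (dslope (iteratedDeriv j f) v) c : ℝ) /
        ((‖v - c‖ - (1 + ρ₀) / ‖K‖) * ‖v - c‖) := by
    rw [show (fun i ↦ m i / ((‖v - a i‖ - (1 + ρ₀) / ‖K‖) * ‖v - a i‖)) =
        fun i ↦ m i * (1 / ((‖v - a i‖ - (1 + ρ₀) / ‖K‖) * ‖v - a i‖)) from funext fun i ↦ by ring, ← h3]
    exact tsum_congr fun c ↦ by ring
  have hend : (1 + ρ₀) * ((1 + ρ₀) / ‖K‖ *
      ∑' i, m i / ((‖v - a i‖ - (1 + ρ₀) / ‖K‖) * ‖v - a i‖)) < ρ₀ * ‖K‖ := by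
    rw [hEq]
    exact hendZ
  exact succ_of_newton_door_twoPointU hE hv hK hKy hρ₀ hoff a m hm hzeros' hineq hSv hδ hsep hend hslack

/-- **The same door ON THE LEGAL FRAME**: the analytic inputs `hFd`, `hgrowth`, `hρ` (growth of `f^{(j)}` with SOME
exponent `< 2`) and `hFv` are DISCHARGED from `EngineHyps5` / `StTrkDQ` by the tree's `realEntireLt2_of_hyps`
(`R3ColumnImmunity`), `exists_growth_iteratedDeriv` + `differentiable_iteratedDeriv_of_entire` (`Literature/JensenCircles`)
and the membership conjunct of `StColQ'`. What remains is door data only: simplicity of `v`, `K`, `ρ₀`, the offset,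
`δ`-separation, the intrinsic END number and the slack. -/
theorem succ_of_newton_door_genusOne_frame {η : ℝ} {f : ℂ → ℂ} {x₀ s hmax R Hs : ℝ} {B j : ℕ} {v : ℂ}
    (hE : EngineHyps5 2 η f x₀ s hmax R Hs B) (hv : StTrkDQ η f x₀ s hmax R Hs B j v)
    (hsimple : analyticOrderAt (iteratedDeriv j f) v = 1)
    {K : ℂ} (hKdef : K = deriv (dslope (iteratedDeriv j f) v) v / dslope (iteratedDeriv j f) v v)
    (hK : K ≠ 0) (hKy : 1 < ‖K‖ * v.im)
    {ρ₀ : ℝ} (hρ₀ : 0 < ρ₀) (hoff : ρ₀ / ‖K‖ ≤ |(v - K⁻¹).im|)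
    {δ : ℝ} (hδ : 0 < δ)
    (hsepZ : ∀ c, dslope (iteratedDeriv j f) v c = 0 → (1 + ρ₀) / ‖K‖ + δ ≤ ‖v - c‖)
    (hendZ : (1 + ρ₀) * ((1 + ρ₀) / ‖K‖ * ∑' c : ℂ, (analyticOrderNatAt (dslope (iteratedDeriv j f) v) c : ℝ) /
        ((‖v - c‖ - (1 + ρ₀) / ‖K‖) * ‖v - c‖)) < ρ₀ * ‖K‖)
    (hslack : (rhoN x₀ R v + (1 + ρ₀) / ‖K‖) ^ 2 + ((j : ℝ) + 1) * (v.im + (1 + ρ₀) / ‖K‖) ^ 2 ≤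
        ((j : ℝ) + 1) * Hs ^ 2) :
    ∃ u : ℂ, StTrkDQ η f x₀ s hmax R Hs B (j + 1) u := by
  have hf : Summit.RiemannHypothesis.RiemannHypothesis.Theorems.Splittings.JensenWindow.RealEntireLt2 f :=
    realEntireLt2_of_hyps hE
  obtain ⟨ρ, C, hρ0, hρ, hgr⟩ := hf.growth
  obtain ⟨ρ', C', -, hρ', hgr'⟩ :=
    Literature.Analysis.Complex.exists_growth_iteratedDeriv hf.diff hρ0 hρ hgr j
  have hv' : StColQ' η f x₀ s hmax R Hs B j v := hv
  obtain ⟨-, hFv, -⟩ := hv'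
  exact succ_of_newton_door_genusOne hE hv
    (Literature.Analysis.Complex.differentiable_iteratedDeriv_of_entire hf.diff j) hgr' hρ' hFv hsimple hKdef hK hKy hρ₀ hoff hδ hsepZ hendZ hslack

end RhW08.NewtonDoorGenusOne
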